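import Literature.AlgebraicGeometry.HodgeTheory.LimitMixedHodgeStructureKerCoker
import Literature.AlgebraicGeometry.HodgeTheory.LimitMixedHodgeStructureBigrading
import Literature.AlgebraicGeometry.Motives.MixedHodgeStructureHodgeNumbersAdditive
import HarnessLib

/-!
# Hodge numbers of `Ker N` and `Coker N` of a limit mixed Hodge structure

For a limit mixed Hodge structure `L = (W, F, N)` of weight `k` (`W = W(N)[-k]`) on a
finite-dimensional `V`, the mixed Hodge structures `Ker N ⊆ L` and `Coker N = V / Im N`
(`LimitMixedHodgeStructureKerCoker.lean`) have Hodge numbers determined by those of `L`.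
Morrison, *The Clemens–Schmid exact sequence and applications*, §2 PROPOSITION, for `K = Ker N`
with `Gr_k(K) = (W_k ∩ K)/(W_{k-1} ∩ K)`: (5) "If `k ≤ m`, `Gr_k(H) ≅ ⊕_{α ≥ 0} Gr_{k-2α}(K)`",
(7) "`Gr_m(H) / Im(N : Gr_{m+2}(H) → Gr_m(H)) ≅ Gr_m(K)`", and §3: "the graded pieces of `H^m_lim`
can be recovered from the graded pieces of `Ker N`". Refined to Deligne's bigrading (Cattani–El
Zein–Griffiths–Lê §7.5, Prop. A.2.2 (2), Prop. A.3.9; the tree's `LimitMixedHodgeStructureBigrading`):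
`I^{a,b}(Ker N) ≅ I^{a,b}(L) ∩ Ker N_ℂ` has dimension `h^{a,b} - h^{a-1,b-1}` at and below the centre
and `0` above it; dually for `Coker N`.

## Main results (all proved; no named facts)

* `hodgeNumber_kerN_eq_finrank` — `h^{a,b}(Ker N) = dim (I^{a,b}(L) ∩ Ker N_ℂ)`;
  `hodgeNumber_cokerN_eq_finrank` — `h^{a,b}(Coker N) = dim π(I^{a,b}(L))`.
* `hodgeNumber_kerN_eq_zero` — `h^{a,b}(Ker N) = 0` for `a + b > k`;
  **`hodgeNumber_kerN_add`** — `h^{a,b}(Ker N) + h^{a-1,b-1}(L) = h^{a,b}(L)` for `a + b ≤ k`.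
* `hodgeNumber_cokerN_add_hodgeNumber` —
  `h^{a,b}(Coker N) + h^{a+1,b+1}(L) = h^{a,b}(L) + h^{a+1,b+1}(Ker N)` (all `a, b`);
  **`hodgeNumber_cokerN_add`** — `h^{a,b}(Coker N) + h^{a+1,b+1}(L) = h^{a,b}(L)` for
  `a + b ≥ k - 1`; `hodgeNumber_cokerN_eq_zero` — `h^{a,b}(Coker N) = 0` for `a + b ≤ k - 2`;
  `hodgeNumber_cokerN_eq_hodgeNumber_kerN` — **`h^{a,b}(Coker N) = h^{a-ℓ,b-ℓ}(Ker N)` for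
  `a + b = k + ℓ`** (`N^ℓ` matches the two ends of each `𝔰𝔩₂`-string), `hodgeNumber_cokerN_eq_of_centre`;
  monotonicity `hodgeNumber_pred_pred_le`, `hodgeNumber_succ_succ_le'`.
* `hodgeNumber_eq_sum_hodgeNumber_kerN_add`, `hodgeNumber_eq_sum_hodgeNumber_kerN` — **Morrison §2
  PROPOSITION (5) `Gr_m(H) ≅ ⊕_{α ≥ 0} Gr_{m-2α}(Ker N)` (`m ≤ k`), bigraded:
  `h^{a,b}(L) = Σ_{α=0}^{n} h^{a-α,b-α}(Ker N) (+ h^{a-n-1,b-n-1}(L))`**; dually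
  `hodgeNumber_eq_sum_hodgeNumber_cokerN_add`, `hodgeNumber_eq_sum_hodgeNumber_cokerN` above the
  centre; `hodgeNumber_eq_zero_of_W_eq_bot`, `hodgeNumber_eq_zero_of_W_pred_eq_top`.

## References

* [Morrison1984ClemensSchmid] D. R. Morrison, *The Clemens–Schmid exact sequence and applications*,
  Ann. of Math. Stud. 106 (1984): §2 PROPOSITION (5), (7) (p. 107), §3 Corollary 1 and the remark
  after it (p. 108), §6 (a) (p. 117).
* [CattaniElZeinGriffithsLe2014] E. Cattani et al. (eds.), *Hodge Theory* (2014): §7.5 (p. 307),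
  Prop. A.2.2 (2), Prop. A.3.9; Lemma 3.2.20, Cor. 3.2.21 (ii).
-/

noncomputable section

open scoped TensorProduct

namespace Literature.AlgebraicGeometry.HodgeTheory

universe u

namespace LimitMixedHodgeStructure

open Module Motives Motives.MixedHodgeStructure

variable {V : Type u} [AddCommGroup V] [Module ℚ V] {k : ℤ} [FiniteDimensional ℚ V]

/-- Rank–nullity for the restriction of `g` to `A`: `dim A = dim (A ∩ ker g) + dim g(A)`. [folklore] -/
private theorem finrank_eq_finrank_inf_ker_add_finrank_map'' {K : Type*} [Field K] {M M' : Type*}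
    [AddCommGroup M] [Module K M] [AddCommGroup M'] [Module K M'] [FiniteDimensional K M]
    (g : M →ₗ[K] M') (A : Submodule K M) :
    finrank K A = finrank K ↥(A ⊓ LinearMap.ker g) + finrank K ↥(A.map g) := by
  have h1 := LinearMap.finrank_range_add_finrank_ker (g.domRestrict A)
  rw [LinearMap.range_domRestrict, LinearMap.ker_domRestrict, ← Submodule.finrank_map_subtype_eq A,
    Submodule.map_comap_subtype] at h1
  omega

/-- **`h^{a,b}(Ker N) = dim_ℂ (I^{a,b}(L) ∩ Ker N_ℂ)`**: Deligne's subspace of the sub-MHS `Ker N` is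
`(Ker N)_ℂ ∩ I^{a,b}(L)` (`SubMixedHodgeStructure.map_deligneI_eq`) and `h^{a,b} = dim I^{a,b}`
(Morrison §2 PROPOSITION (7): `Gr_m(K) = (W_m ∩ K)/(W_{m-1} ∩ K)` inside `Gr_m(H)`).
[cite: Morrison1984ClemensSchmid, §2 Proposition (7), p. 107] -/
theorem hodgeNumber_kerN_eq_finrank (L : LimitMixedHodgeStructure V k) (a b : ℤ) :
    L.kerN.toMixedHodgeStructure.hodgeNumber a b =
      finrank ℂ ↥(L.toMixedHodgeStructure.deligneI a b ⊓ LinearMap.ker (L.N.baseChange ℂ)) := by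
  rw [← finrank_deligneI_eq_hodgeNumber, LinearEquiv.finrank_eq (Submodule.equivMapOfInjective _
    (baseChange_injective L.kerN.toSubmodule.injective_subtype) _), L.kerN.map_deligneI_eq a b,
    kerN_toSubmodule, Literature.LinearAlgebra.BaseChange.baseChange_ker, inf_comm]

/-- **`h^{a,b}(Coker N) = dim_ℂ π(I^{a,b}(L))`**, `π : V_ℂ → (V / Im N)_ℂ`
(`SubMixedHodgeStructure.deligneI_quotient_eq`). [cite: Morrison1984ClemensSchmid, §2 Proposition (7), p. 107] -/
theorem hodgeNumber_cokerN_eq_finrank (L : LimitMixedHodgeStructure V k) (a b : ℤ) :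
    L.cokerN.hodgeNumber a b = finrank ℂ ↥((L.toMixedHodgeStructure.deligneI a b).map
      ((LinearMap.range L.N).mkQ.baseChange ℂ)) := by
  rw [← finrank_deligneI_eq_hodgeNumber]
  change finrank ℂ ↥(L.rangeN.quotient.deligneI a b) = _
  rw [L.rangeN.deligneI_quotient_eq a b, rangeN_toSubmodule]

/-- **`h^{a,b}(Ker N) = 0` above the centre** (`a + b > k`): `N_ℂ` is injective on `I^{a,b}` for
`a + b > k` (`Ker N ⊆ W_k`; Morrison §3, Cor. 1: `W_k(K) = K`). [cite: Morrison1984ClemensSchmid, §3 Corollary 1, p. 108] -/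
theorem hodgeNumber_kerN_eq_zero (L : LimitMixedHodgeStructure V k) {a b : ℤ} (hab : k < a + b) :
    L.kerN.toMixedHodgeStructure.hodgeNumber a b = 0 := by
  rw [L.hodgeNumber_kerN_eq_finrank, L.deligneI_inf_ker_N_eq_bot_of_lt hab, finrank_bot]

/-- **`h^{a,b}(Ker N) + h^{a-1,b-1}(L) = h^{a,b}(L)` at and below the centre** (`a + b ≤ k`):
`Gr_m(Ker N) = Ker(N : Gr_m H → Gr_{m-2} H)` with `N` onto for `m ≤ k + 1` (Morrison §2
PROPOSITION (5)/(7); Cattani et al., Prop. A.3.9), `N` has bidegree `(-1,-1)`, and the limit Hodge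
numbers are symmetric about the centre (`h^{a,b} = h^{k-b,k-a}`).
[cite: Morrison1984ClemensSchmid, §2 Proposition (5) and (7), p. 107] -/
theorem hodgeNumber_kerN_add (L : LimitMixedHodgeStructure V k) {a b : ℤ} (hab : a + b ≤ k) :
    L.kerN.toMixedHodgeStructure.hodgeNumber a b +
        L.toMixedHodgeStructure.hodgeNumber (a - 1) (b - 1) =
      L.toMixedHodgeStructure.hodgeNumber a b := by
  obtain ⟨ℓ, hℓ⟩ : ∃ ℓ : ℕ, a + b = k - ℓ := ⟨(k - (a + b)).toNat, by omega⟩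
  have h := L.finrank_deligneI_inf_ker_add ℓ hℓ
  rw [← L.hodgeNumber_kerN_eq_finrank, finrank_deligneI_eq_hodgeNumber,
    finrank_deligneI_eq_hodgeNumber, L.hodgeNumber_eq (a + ℓ) (b + ℓ),
    L.hodgeNumber_eq (a + ℓ + 1) (b + ℓ + 1), show k - (b + ℓ) = a by omega,
    show k - (a + ℓ) = b by omega, show k - (b + ℓ + 1) = a - 1 by omega,
    show k - (a + ℓ + 1) = b - 1 by omega] at h
  exact h

/-- For `a + b ≤ k`, `h^{a-1,b-1}(L) ≤ h^{a,b}(L)` (the limit Hodge numbers increase towards the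
centre along each diagonal). [cite: Morrison1984ClemensSchmid, §2 Proposition (5), p. 107] -/
theorem hodgeNumber_pred_pred_le (L : LimitMixedHodgeStructure V k) {a b : ℤ} (hab : a + b ≤ k) :
    L.toMixedHodgeStructure.hodgeNumber (a - 1) (b - 1) ≤ L.toMixedHodgeStructure.hodgeNumber a b := by
  rw [← L.hodgeNumber_kerN_add hab]
  exact Nat.le_add_left _ _

/-- **`h^{a,b}(Coker N) + h^{a+1,b+1}(L) = h^{a,b}(L) + h^{a+1,b+1}(Ker N)`** for all `a, b`:
`h^{a,b}(Coker N) = dim I^{a,b} - dim (I^{a,b} ∩ Im N_ℂ)` and `I^{a,b} ∩ Im N_ℂ = N_ℂ I^{a+1,b+1}`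
(`N` strict of bidegree `(-1,-1)`, Cattani et al., Thm. 7.5.6 with Prop. A.2.2 (2)), whose dimension
is `h^{a+1,b+1} - h^{a+1,b+1}(Ker N)`. [cite: Morrison1984ClemensSchmid, §2 Proposition (7), p. 107] -/
theorem hodgeNumber_cokerN_add_hodgeNumber (L : LimitMixedHodgeStructure V k) (a b : ℤ) :
    L.cokerN.hodgeNumber a b + L.toMixedHodgeStructure.hodgeNumber (a + 1) (b + 1) =
      L.toMixedHodgeStructure.hodgeNumber a b +
        L.kerN.toMixedHodgeStructure.hodgeNumber (a + 1) (b + 1) := by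
  have hker : LinearMap.ker ((LinearMap.range L.N).mkQ.baseChange ℂ) =
      LinearMap.range (L.N.baseChange ℂ) := by
    rw [ker_mkQ_baseChange, range_baseChange]
  have h1 := finrank_eq_finrank_inf_ker_add_finrank_map'' ((LinearMap.range L.N).mkQ.baseChange ℂ)
    (L.toMixedHodgeStructure.deligneI a b)
  rw [hker, L.deligneI_inf_range_N_eq a b, ← L.hodgeNumber_cokerN_eq_finrank,
    finrank_deligneI_eq_hodgeNumber] at h1
  have h2 := finrank_eq_finrank_inf_ker_add_finrank_map'' (L.N.baseChange ℂ)
    (L.toMixedHodgeStructure.deligneI (a + 1) (b + 1))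
  rw [← L.hodgeNumber_kerN_eq_finrank, finrank_deligneI_eq_hodgeNumber] at h2
  omega

/-- **`h^{a,b}(Coker N) + h^{a+1,b+1}(L) = h^{a,b}(L)` for `a + b ≥ k - 1`** (there
`h^{a+1,b+1}(Ker N) = 0`: above the centre `N` is injective on `I^{a+1,b+1}`; Morrison §2 (7) at the
centre: `Gr_k(H)/Im(N : Gr_{k+2} → Gr_k) ≅ Gr_k(K)`). [cite: Morrison1984ClemensSchmid, §2 Proposition (7), p. 107] -/
theorem hodgeNumber_cokerN_add (L : LimitMixedHodgeStructure V k) {a b : ℤ} (hab : k - 1 ≤ a + b) :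
    L.cokerN.hodgeNumber a b + L.toMixedHodgeStructure.hodgeNumber (a + 1) (b + 1) =
      L.toMixedHodgeStructure.hodgeNumber a b := by
  have h := L.hodgeNumber_cokerN_add_hodgeNumber a b
  rw [L.hodgeNumber_kerN_eq_zero (a := a + 1) (b := b + 1) (by omega), add_zero] at h
  exact h

/-- For `a + b ≥ k - 1`, `h^{a+1,b+1}(L) ≤ h^{a,b}(L)` (cf. `hodgeNumber_succ_succ_le` for `a + b ≥ k`).
[cite: Morrison1984ClemensSchmid, §2 Proposition (5), p. 107] -/
theorem hodgeNumber_succ_succ_le' (L : LimitMixedHodgeStructure V k) {a b : ℤ} (hab : k - 1 ≤ a + b) :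
    L.toMixedHodgeStructure.hodgeNumber (a + 1) (b + 1) ≤ L.toMixedHodgeStructure.hodgeNumber a b := by
  rw [← L.hodgeNumber_cokerN_add hab]
  exact Nat.le_add_left _ _

/-- **`h^{a,b}(Coker N) = 0` for `a + b ≤ k - 2`** (`W_{k-1}(Coker N) = 0`: `Coker N` has weights
`≥ k`; Morrison §2 PROPOSITION (2)–(3)). [cite: Morrison1984ClemensSchmid, §2 Proposition, p. 107] -/
theorem hodgeNumber_cokerN_eq_zero (L : LimitMixedHodgeStructure V k) {a b : ℤ} (hab : a + b ≤ k - 2) :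
    L.cokerN.hodgeNumber a b = 0 := by
  have h1 := L.hodgeNumber_cokerN_add_hodgeNumber a b
  have h2 := L.hodgeNumber_kerN_add (a := a + 1) (b := b + 1) (by omega)
  rw [add_sub_cancel_right, add_sub_cancel_right] at h2
  omega

/-- **`h^{a,b}(Coker N) = h^{a-ℓ,b-ℓ}(Ker N)` for `a + b = k + ℓ`**: `N^ℓ : Gr_{k+ℓ} ⥲ Gr_{k-ℓ}`
matches the top `(a,b)` of each `𝔰𝔩₂`-string of length `ℓ` (a class of `Coker N`) with its bottom
`(a-ℓ,b-ℓ)` (a class of `Ker N`) — Morrison §2 PROPOSITION (3)/(5): the graded pieces of `H` are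
recovered from those of `Ker N`. [cite: Morrison1984ClemensSchmid, §2 Proposition (3) and (5), p. 107] -/
theorem hodgeNumber_cokerN_eq_hodgeNumber_kerN (L : LimitMixedHodgeStructure V k) (ℓ : ℕ) {a b : ℤ}
    (hab : a + b = k + ℓ) :
    L.cokerN.hodgeNumber a b = L.kerN.toMixedHodgeStructure.hodgeNumber (a - ℓ) (b - ℓ) := by
  have h1 := L.hodgeNumber_cokerN_add (a := a) (b := b) (by omega)
  have h2 := L.hodgeNumber_kerN_add (a := a - ℓ) (b := b - ℓ) (by omega)
  rw [L.hodgeNumber_eq (a - ℓ) (b - ℓ), L.hodgeNumber_eq (a - ℓ - 1) (b - ℓ - 1),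
    show k - (b - ℓ) = a by omega, show k - (a - ℓ) = b by omega,
    show k - (b - ℓ - 1) = a + 1 by omega, show k - (a - ℓ - 1) = b + 1 by omega] at h2
  omega

/-- At the centre: **`h^{a,b}(Coker N) = h^{a,b}(Ker N)` for `a + b = k`** (strings of length `0`).
[cite: Morrison1984ClemensSchmid, §2 Proposition (7), p. 107] -/
theorem hodgeNumber_cokerN_eq_of_centre (L : LimitMixedHodgeStructure V k) {a b : ℤ} (hab : a + b = k) :
    L.cokerN.hodgeNumber a b = L.kerN.toMixedHodgeStructure.hodgeNumber a b := by
  have h := L.hodgeNumber_cokerN_eq_hodgeNumber_kerN 0 (a := a) (b := b) (by simpa using hab)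
  simpa using h

/-! ### Morrison §2 PROPOSITION (5): the graded pieces of `H` from those of `Ker N` (and `Coker N`) -/

/-- The Hodge numbers of `L` vanish where the weight filtration does: `h^{p,q}(L) = 0` if
`W_{p+q} = 0` (`I^{p,q} ⊆ W_{p+q,ℂ}`). [cite: CattaniElZeinGriffithsLe2014, Prop. 3.2.19] -/
theorem hodgeNumber_eq_zero_of_W_eq_bot (L : LimitMixedHodgeStructure V k) {p q : ℤ}
    (h : L.W (p + q) = ⊥) : L.toMixedHodgeStructure.hodgeNumber p q = 0 := by
  have h0 : L.toMixedHodgeStructure.deligneI p q = ⊥ := by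
    refine eq_bot_iff.2 ((L.toMixedHodgeStructure.deligneI_le_W p q).trans (le_of_eq ?_))
    rw [show L.toMixedHodgeStructure.W (p + q) = L.W (p + q) from rfl, h, Submodule.baseChange_bot]
  rw [← finrank_deligneI_eq_hodgeNumber, h0, finrank_bot]

/-- **Morrison §2 PROPOSITION (5), bigraded and telescoped: for `a + b ≤ k`,
`h^{a,b}(L) = Σ_{α=0}^{n} h^{a-α,b-α}(Ker N) + h^{a-n-1,b-n-1}(L)`** ("`Gr_k(H) ≅ ⊕_{α ≥ 0} Gr_{k-2α}(K)`
if `k ≤ m`": iterate `h^{a,b}(L) = h^{a,b}(Ker N) + h^{a-1,b-1}(L)` down the diagonal).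
[cite: Morrison1984ClemensSchmid, §2 Proposition (5), p. 107] -/
theorem hodgeNumber_eq_sum_hodgeNumber_kerN_add (L : LimitMixedHodgeStructure V k) {a b : ℤ}
    (hab : a + b ≤ k) (n : ℕ) :
    L.toMixedHodgeStructure.hodgeNumber a b =
      (∑ α ∈ Finset.range (n + 1), L.kerN.toMixedHodgeStructure.hodgeNumber (a - α) (b - α)) +
        L.toMixedHodgeStructure.hodgeNumber (a - (n + 1)) (b - (n + 1)) := by
  induction n with
  | zero =>
    simp only [Finset.sum_range_one, Nat.cast_zero, sub_zero, zero_add]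
    exact (L.hodgeNumber_kerN_add hab).symm
  | succ n ih =>
    rw [Finset.sum_range_succ, ih, add_assoc, add_left_cancel_iff]
    push_cast
    rw [← L.hodgeNumber_kerN_add (a := a - (n + 1)) (b := b - (n + 1)) (by omega),
      show a - ((n : ℤ) + 1) - 1 = a - ((n : ℤ) + 1 + 1) by ring,
      show b - ((n : ℤ) + 1) - 1 = b - ((n : ℤ) + 1 + 1) by ring]

/-- **`h^{a,b}(L) = Σ_{α=0}^{n} h^{a-α,b-α}(Ker N)` for `a + b ≤ k` once `W_{a+b-2(n+1)} = 0`**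
(Morrison §2 PROPOSITION (5): `Gr_m(H) ≅ ⊕_{α ≥ 0} Gr_{m-2α}(K)` for `m` at or below the centre —
the graded pieces of `H^m_lim` are recovered from those of `Ker N`, §3).
[cite: Morrison1984ClemensSchmid, §2 Proposition (5), p. 107] -/
theorem hodgeNumber_eq_sum_hodgeNumber_kerN (L : LimitMixedHodgeStructure V k) {a b : ℤ}
    (hab : a + b ≤ k) (n : ℕ) (hn : L.W (a + b - 2 * (n + 1)) = ⊥) :
    L.toMixedHodgeStructure.hodgeNumber a b =
      ∑ α ∈ Finset.range (n + 1), L.kerN.toMixedHodgeStructure.hodgeNumber (a - α) (b - α) := by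
  rw [L.hodgeNumber_eq_sum_hodgeNumber_kerN_add hab n, L.hodgeNumber_eq_zero_of_W_eq_bot, add_zero]
  rw [show a - ((n : ℤ) + 1) + (b - ((n : ℤ) + 1)) = a + b - 2 * (n + 1) by ring]
  exact hn

/-- Dually, above the centre the Hodge numbers of `L` are recovered from those of `Coker N`:
**`h^{a,b}(L) = Σ_{α=0}^{n} h^{a+α,b+α}(Coker N) + h^{a+n+1,b+n+1}(L)` for `a + b ≥ k - 1`**
(iterate `h^{a,b}(L) = h^{a,b}(Coker N) + h^{a+1,b+1}(L)`; Morrison §2 PROPOSITION (3)/(5) with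
`Coker N` at the top of each string). [cite: Morrison1984ClemensSchmid, §2 Proposition (3) and (5), p. 107] -/
theorem hodgeNumber_eq_sum_hodgeNumber_cokerN_add (L : LimitMixedHodgeStructure V k) {a b : ℤ}
    (hab : k - 1 ≤ a + b) (n : ℕ) :
    L.toMixedHodgeStructure.hodgeNumber a b =
      (∑ α ∈ Finset.range (n + 1), L.cokerN.hodgeNumber (a + α) (b + α)) +
        L.toMixedHodgeStructure.hodgeNumber (a + (n + 1)) (b + (n + 1)) := by
  induction n with
  | zero =>
    simp only [Finset.sum_range_one, Nat.cast_zero, add_zero, zero_add]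
    exact (L.hodgeNumber_cokerN_add hab).symm
  | succ n ih =>
    rw [Finset.sum_range_succ, ih, add_assoc, add_left_cancel_iff]
    push_cast
    rw [← L.hodgeNumber_cokerN_add (a := a + (n + 1)) (b := b + (n + 1)) (by omega),
      show a + ((n : ℤ) + 1) + 1 = a + ((n : ℤ) + 1 + 1) by ring,
      show b + ((n : ℤ) + 1) + 1 = b + ((n : ℤ) + 1 + 1) by ring]

/-- The Hodge numbers of `L` vanish above the top weight: `h^{p,q}(L) = 0` if `W_{p+q-1} = V`.
[cite: CattaniElZeinGriffithsLe2014, Prop. 3.2.19] -/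
theorem hodgeNumber_eq_zero_of_W_pred_eq_top (L : LimitMixedHodgeStructure V k) {p q : ℤ}
    (h : L.W (p + q - 1) = ⊤) : L.toMixedHodgeStructure.hodgeNumber p q = 0 := by
  rw [← finrank_deligneI_eq_hodgeNumber, L.deligneI_eq_bot_of_W_pred_eq_top h, finrank_bot]

/-- **`h^{a,b}(L) = Σ_{α=0}^{n} h^{a+α,b+α}(Coker N)` for `a + b ≥ k - 1` once `W` is exhausted:
`W_{a+b+2n+1} = V`** (then `h^{a+n+1,b+n+1}(L) = 0`). [cite: Morrison1984ClemensSchmid, §2 Proposition (3) and (5), p. 107] -/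
theorem hodgeNumber_eq_sum_hodgeNumber_cokerN (L : LimitMixedHodgeStructure V k) {a b : ℤ}
    (hab : k - 1 ≤ a + b) (n : ℕ) (hn : L.W (a + b + 2 * n + 1) = ⊤) :
    L.toMixedHodgeStructure.hodgeNumber a b =
      ∑ α ∈ Finset.range (n + 1), L.cokerN.hodgeNumber (a + α) (b + α) := by
  rw [L.hodgeNumber_eq_sum_hodgeNumber_cokerN_add hab n, L.hodgeNumber_eq_zero_of_W_pred_eq_top,
    add_zero]
  rw [show a + ((n : ℤ) + 1) + (b + ((n : ℤ) + 1)) - 1 = a + b + 2 * n + 1 by ring]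
  exact hn

end LimitMixedHodgeStructure

end Literature.AlgebraicGeometry.HodgeTheory

end
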